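import Mathlib.Topology.Order.IntermediateValue
import Mathlib.Topology.Order.MonotoneContinuity
import Mathlib.Topology.Algebra.Order.Field
import Mathlib.Topology.Instances.Real.Lemmas
import Mathlib.Order.ConditionallyCompleteLattice.Indexed

/-!
# SoloInformed — order and nesting of disjoint leaves (the combinatorial core of the NESTING LEMMA of (G8))

Soloist `solo-FinalStateConjecture-informed` (session 11, 2026-08-19). Pure order/topology, no geometry
imported: the three elementary facts that drive §4 of the soloist's note `paper/TILT.md` ((G8) TILT
RIGIDITY) about the late flat leaves `L_τ = Ψ₀({x⁰ = τ})` of a typed `N = 0` final-state decomposition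
inside a region carrying a static-type frame `π : U → N`, `N ≅ ℝ³` connected.

Dictionary. By the GRAPH LEMMA (TILT.md (4.1): a connected complete spacelike hypersurface in `U` is an
entire graph over the orbit space, via Lee, *Riemannian Manifolds* (2018) Thm. 6.23) each late leaf is
`L_τ = {t = f_τ(x)}` for a continuous height function `f_τ : N → ℝ`; distinct leaves are disjoint
(they are images of disjoint slabs under one embedding), i.e. `f_τ x ≠ f_τ' x` for all `x` when
`τ ≠ τ'`; and along the fibre over a fixed base point `x₀` the crossing height `τ ↦ f_τ(x₀)` is
continuous (transversality of a timelike fibre to spacelike leaves). With `X := N`, `F τ := f_τ`: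

* `leaf_forall_lt_of_forall_ne`: two never-coinciding continuous height functions on a preconnected
  base that are ordered at ONE point are strictly ordered everywhere (the set `{f < g}` is clopen);
  `leaf_forall_lt_or_forall_gt_of_forall_ne`: hence disjoint entire graphs are nested one way or the other.
* `leafNesting_forall_lt` (NESTING LEMMA, TILT.md (4.2)): a pairwise-disjoint family of such graphs whose
  crossing height along ONE fibre is continuous in the parameter is strictly increasing in `τ`
  pointwise on the whole base as soon as one pair `τ₁ < τ₂` is ordered upward at one point
  (continuous + injective on a densely ordered conditionally complete parameter line ⇒ strictly
  monotone or antitone; the sign transfers between base points by the first lemma). In TILT.md the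
  upward sign comes from local future-orientation of the chart (`IsFutureOriented`); here it is the
  hypothesis `hx₁`.
* `leaf_central_dichotomy` (CENTRAL DICHOTOMY, TILT.md (4.3)): a monotone central crossing time
  `m τ = f_τ(0)` bounded above by the excision time `t_B` either stays uniformly before the shell
  arrival time (`∃ c₀ > 0, m ≤ t_arr - c₀`: the "pre" branch) or eventually enters and stays in every
  window `(t_arr - c₀, t_B)` (the "focal" branch: pile-up in the compact focal zone).

These are the formal shadow of the structural half of THEOREM G8 (no typed `N = 0` decomposition for
shell-collapse developments, conditional on strong-field walls); the analytic half (tilt/height/apex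
bounds) is `SoloInformedTiltBound.lean`.

References: [Lee2018] Thm. 6.23 (covering criterion used in the dictionary only); [ONeill1983] Ch. 14
(time functions, Cauchy developments) for the setting.
-/

open Set Function

set_option linter.dupNamespace false

namespace Summit.FinalStateConjecture.FinalStateConjecture.Theorems

/-- ORDER OF DISJOINT GRAPHS. On a preconnected space, two continuous real functions that never take the
same value and satisfy `f x₀ < g x₀` at one point satisfy `f x < g x` at every point: the set
`{x | f x < g x}` is open, and its complement `{x | g x < f x}` (by `f ≠ g` pointwise) is open too. -/
theorem leaf_forall_lt_of_forall_ne {X : Type*} [TopologicalSpace X] [PreconnectedSpace X]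
    {f g : X → ℝ} (hf : Continuous f) (hg : Continuous g) (hne : ∀ x, f x ≠ g x)
    {x₀ : X} (h₀ : f x₀ < g x₀) : ∀ x, f x < g x := by
  have hopen : IsOpen {x | f x < g x} := isOpen_lt hf hg
  have hcompl : {x | f x < g x}ᶜ = {x | g x < f x} := by
    ext x
    simp only [mem_compl_iff, mem_setOf_eq, not_lt]
    exact ⟨fun h => lt_of_le_of_ne h (fun h' => hne x h'.symm), fun h => h.le⟩
  have hclosed : IsClosed {x | f x < g x} := by
    rw [← isOpen_compl_iff, hcompl]
    exact isOpen_lt hg hf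
  have hclopen : IsClopen {x | f x < g x} := ⟨hclosed, hopen⟩
  rcases isClopen_iff.mp hclopen with h | h
  · have hx : x₀ ∈ {x | f x < g x} := h₀
    rw [h] at hx
    exact absurd hx (by simp)
  · intro x
    have hx : x ∈ ({x | f x < g x} : Set X) := by rw [h]; exact mem_univ x
    exact hx

/-- Disjoint entire graphs over a preconnected base are NESTED: one lies strictly below the other. -/
theorem leaf_forall_lt_or_forall_gt_of_forall_ne {X : Type*} [TopologicalSpace X] [PreconnectedSpace X]
    {f g : X → ℝ} (hf : Continuous f) (hg : Continuous g) (hne : ∀ x, f x ≠ g x) :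
    (∀ x, f x < g x) ∨ (∀ x, g x < f x) := by
  rcases isEmpty_or_nonempty X with hX | ⟨⟨x₀⟩⟩
  · exact Or.inl (fun x => (IsEmpty.false x).elim)
  · rcases lt_or_gt_of_ne (hne x₀) with h | h
    · exact Or.inl (leaf_forall_lt_of_forall_ne hf hg hne h)
    · exact Or.inr (leaf_forall_lt_of_forall_ne hg hf (fun x h' => hne x h'.symm) h)

/-- NESTING LEMMA (TILT.md (4.2)). Let `F : ι → X → ℝ` be a family of continuous functions on a
preconnected space `X`, indexed by a densely ordered conditionally complete linear order `ι` with its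
order topology (e.g. `ℝ`, or an open interval of chart times), pairwise never coinciding
(`F τ x ≠ F τ' x` for `τ ≠ τ'`), and such that along ONE base point `x₀` the map `τ ↦ F τ x₀` is
continuous. If for one pair `τ₁ < τ₂` and one point `x₁` we have `F τ₁ x₁ < F τ₂ x₁`, then the family
is strictly increasing pointwise: `F τ x < F τ' x` for all `τ < τ'` and all `x`. -/
theorem leafNesting_forall_lt {ι X : Type*} [ConditionallyCompleteLinearOrder ι] [TopologicalSpace ι]
    [OrderTopology ι] [DenselyOrdered ι] [TopologicalSpace X] [PreconnectedSpace X]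
    (F : ι → X → ℝ) (hcont : ∀ τ, Continuous (F τ))
    (hdisj : ∀ τ τ', τ ≠ τ' → ∀ x, F τ x ≠ F τ' x)
    (x₀ : X) (hline : Continuous fun τ => F τ x₀)
    {τ₁ τ₂ : ι} (h12 : τ₁ < τ₂) {x₁ : X} (hx₁ : F τ₁ x₁ < F τ₂ x₁) :
    ∀ τ τ', τ < τ' → ∀ x, F τ x < F τ' x := by
  have hinj : Injective fun τ => F τ x₀ := by
    intro τ τ' h
    by_contra hne
    exact hdisj τ τ' hne x₀ h
  have h0 : F τ₁ x₀ < F τ₂ x₀ :=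
    leaf_forall_lt_of_forall_ne (hcont τ₁) (hcont τ₂) (hdisj τ₁ τ₂ h12.ne) hx₁ x₀
  rcases hline.strictMono_of_inj hinj with hmono | hanti
  · intro τ τ' hlt x
    exact leaf_forall_lt_of_forall_ne (hcont τ) (hcont τ') (hdisj τ τ' hlt.ne) (hmono hlt) x
  · exact absurd h0 (not_lt.mpr (hanti h12).le)

/-- Pointwise monotonicity of every crossing height, as used in TILT.md (4.2) "CONSEQUENCES":
under the hypotheses of `leafNesting_forall_lt`, each `τ ↦ F τ x` is strictly monotone. -/
theorem leafNesting_strictMono {ι X : Type*} [ConditionallyCompleteLinearOrder ι] [TopologicalSpace ι]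
    [OrderTopology ι] [DenselyOrdered ι] [TopologicalSpace X] [PreconnectedSpace X]
    (F : ι → X → ℝ) (hcont : ∀ τ, Continuous (F τ))
    (hdisj : ∀ τ τ', τ ≠ τ' → ∀ x, F τ x ≠ F τ' x)
    (x₀ : X) (hline : Continuous fun τ => F τ x₀)
    {τ₁ τ₂ : ι} (h12 : τ₁ < τ₂) {x₁ : X} (hx₁ : F τ₁ x₁ < F τ₂ x₁) (x : X) :
    StrictMono fun τ => F τ x :=
  fun _ _ hlt => leafNesting_forall_lt F hcont hdisj x₀ hline h12 hx₁ _ _ hlt x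

/-- CENTRAL DICHOTOMY (TILT.md (4.3)). A monotone central crossing time `m` (non-decreasing in the leaf
parameter) that stays strictly below the excision time `tB` either (pre) stays uniformly before the
arrival time `tArr` — `m τ ≤ tArr - c₀` for some `c₀ > 0` and all `τ` — or (focal) for every `c₀ > 0`
eventually lies in the window `(tArr - c₀, tB)` for all later parameters. -/
theorem leaf_central_dichotomy (m : ℝ → ℝ) (hm : Monotone m) (tB tArr : ℝ) (hB : ∀ τ, m τ < tB) :
    (∃ c₀ > 0, ∀ τ, m τ ≤ tArr - c₀) ∨
      (∀ c₀ > 0, ∃ τ₀, ∀ τ, τ₀ ≤ τ → tArr - c₀ < m τ ∧ m τ < tB) := by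
  have hbdd : BddAbove (range m) := ⟨tB, by rintro _ ⟨τ, rfl⟩; exact (hB τ).le⟩
  set L := ⨆ τ, m τ with hL
  have hle : ∀ τ, m τ ≤ L := fun τ => le_ciSup hbdd τ
  rcases lt_or_ge L tArr with hlt | hlt
  · refine Or.inl ⟨tArr - L, by linarith, fun τ => ?_⟩
    have := hle τ
    linarith
  · refine Or.inr fun c₀ hc₀ => ?_
    have hlt' : L - c₀ < L := by linarith
    obtain ⟨τ₀, hτ₀⟩ : ∃ τ₀, L - c₀ < m τ₀ := exists_lt_of_lt_ciSup (by rwa [← hL])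
    refine ⟨τ₀, fun τ hτ => ⟨?_, hB τ⟩⟩
    have := hm hτ
    linarith

end Summit.FinalStateConjecture.FinalStateConjecture.Theorems
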